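import Summits.AnomalousDissipation.AnomalousDissipation.Theorems.SawtoothPulseCascadeK1LocalisedCascadeKHModeCreation

/-!
# K2 lane (route-2 `SawtoothPulseCascade`, crux dir `K1LocalisedCascade`): the non-resonant TAIL of the sharp single-mode law

Helper file of the K2 lane (ACL item stmt-AnomalousDissipation-19491; E6 far rows / E2, arbiter A27-1 (iii), A27-4). A mode `ξ` with `u = ξ/a ≥ θ`
never un-tilts inside the slot of strain `θ`; its envelope factor `I₊ + I₋ = arsinh(u+θ) − arsinh(u−θ)` is at most `2θ/√(1+(u−θ)²)` (mean value:
`arsinh' ≤ 1/√(1+(u−θ)²)` on `[u−θ, u+θ]`; `arsinh_window_le_far`), so the created amplitude is `O(θ/(a(u−θ))) = O(θ/(|ξ| − aθ))` — the decay that makes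
far columns' creation on lower lines small (`mode_factor_far_le`: `≤ 2.57/(a·√(1+(u−θ)²))` for `a ≥ 4`, `θ ≤ 8`, `u ≥ θ`). No definitions; no statement
about the crux. [folklore] [problem: turb]
-/

-- `Summit.<Summit>.<Problem>`: single-conjunct summit, the duplicate namespace segment is deliberate.
set_option linter.dupNamespace false

noncomputable section

namespace Summit.AnomalousDissipation.AnomalousDissipation.Theorems.SawtoothPulseCascade.K2PhaseBudget

open Set MeasureTheory intervalIntegral Literature.Analysis.FluidPDE.SawtoothCascade

/-- **The far window bound:** for `0 ≤ θ ≤ u`, `arsinh(u+θ) − arsinh(u−θ) ≤ 2θ/√(1+(u−θ)²)` (the window sits to the right of `0`, where `arsinh` is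
concave with slope `≤ 1/√(1+(u−θ)²)`). [folklore] -/
theorem arsinh_window_le_far {θ u : ℝ} (hθ : 0 ≤ θ) (hu : θ ≤ u) :
    Real.arsinh (u + θ) - Real.arsinh (u - θ) ≤ 2 * θ / Real.sqrt (1 + (u - θ) ^ 2) := by
  have hx0 : 0 ≤ u - θ := by linarith
  have hbound : ∀ x ∈ interior (Set.Ici (u - θ)), deriv Real.arsinh x ≤ (Real.sqrt (1 + (u - θ) ^ 2))⁻¹ := by
    intro x hx
    rw [interior_Ici] at hx
    rw [(Real.hasDerivAt_arsinh x).deriv]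
    have hx' : u - θ < x := hx
    have hle : Real.sqrt (1 + (u - θ) ^ 2) ≤ Real.sqrt (1 + x ^ 2) := Real.sqrt_le_sqrt (by nlinarith)
    exact inv_anti₀ (Real.sqrt_pos.2 (by positivity)) hle
  have h := (convex_Ici (u - θ)).image_sub_le_mul_sub_of_deriv_le Real.continuous_arsinh.continuousOn
    (Real.differentiable_arsinh.differentiableOn) hbound (u - θ) (Set.mem_Ici.2 le_rfl) (u + θ) (Set.mem_Ici.2 (by linarith)) (by linarith)
  rw [show u + θ - (u - θ) = 2 * θ by ring] at h
  rw [div_eq_mul_inv, mul_comm]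
  linarith

/-- **Non-resonant tail of the mode factor:** for `a ≥ 4`, `0 ≤ θ ≤ 8`, `u = ξ/a ≥ θ`:
`4πa(a·p+2a‖S‖)/ω · (N₊I₊ + N₋I₋)/((1−q)2κ·κ) ≤ 2.57/(a·√(1+(ξ/a−θ)²))`. [folklore] -/
theorem mode_factor_far_le {a : ℝ} (ha : 4 ≤ a) (β ξ : ℝ) {θ : ℝ} (hθ0 : 0 ≤ θ) (hθ : θ ≤ 8) (hu : θ ≤ ξ / a) :
    4 * Real.pi * a * (a * (Real.pi / 2 + 2 * sawSigma0 a β) + 2 * a * ‖sawS a β‖) / (a * Real.sqrt (max 0 (sawC2 a β))) *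
        (((1 + 2 * Real.exp (-(2 * Real.pi * a) / 4) + 2 * Real.exp (-(2 * Real.pi * a) / 4) ^ 2 + 2 * Real.exp (-(2 * Real.pi * a) / 4) ^ 3 +
            Real.exp (-(2 * Real.pi * a) / 4) ^ 4) * (Real.arsinh (ξ / a + θ) - Real.arsinh (ξ / a)) +
          (1 + 2 * Real.exp (-(2 * Real.pi * a) / 4) ^ 2 + Real.exp (-(2 * Real.pi * a) / 4) ^ 4) * (Real.arsinh (ξ / a) - Real.arsinh (ξ / a - θ))) /
          (((1 - Real.exp (-(2 * Real.pi * a))) * (2 * (2 * Real.pi * a))) * (2 * Real.pi * a))) ≤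
      2.57 / (a * Real.sqrt (1 + (ξ / a - θ) ^ 2)) := by
  have ha1 : 1 ≤ a := by linarith
  have ha0 : 0 < a := by linarith
  have hπ : (3.1415 : ℝ) < Real.pi := Real.pi_gt_d4
  have hR : (a * (Real.pi / 2 + 2 * sawSigma0 a β) + 2 * a * ‖sawS a β‖) / (a * Real.sqrt (max 0 (sawC2 a β))) ≤ 1.00002 :=
    (comb_ratio_le ha1 β).trans (by linarith [comb_ratio_defect_le ha β])
  have hR0 : 0 ≤ (a * (Real.pi / 2 + 2 * sawSigma0 a β) + 2 * a * ‖sawS a β‖) / (a * Real.sqrt (max 0 (sawC2 a β))) := by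
    have := kh_p_ge ha1 β; positivity
  have hx := exp_neg_quarter_kappa_le ha
  have hx0 : 0 ≤ Real.exp (-(2 * Real.pi * a) / 4) := (Real.exp_pos _).le
  have hq : Real.exp (-(2 * Real.pi * a)) ≤ (1 / 400) ^ 4 := exp_neg_kappa_le_pow ha
  have hq0 : 0 < Real.exp (-(2 * Real.pi * a)) := Real.exp_pos _
  set x := Real.exp (-(2 * Real.pi * a) / 4) with hxdef
  set q := Real.exp (-(2 * Real.pi * a)) with hqdef
  set u := ξ / a with hudef
  set R := (a * (Real.pi / 2 + 2 * sawSigma0 a β) + 2 * a * ‖sawS a β‖) / (a * Real.sqrt (max 0 (sawC2 a β))) with hR_def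
  set W := Real.sqrt (1 + (u - θ) ^ 2) with hW
  have hW0 : 0 < W := Real.sqrt_pos.2 (by positivity)
  -- the envelope factor: `N₋ ≤ N₊`, `I₊, I₋ ≥ 0`, `I₊ + I₋ ≤ 2θ/W`
  have hIp : 0 ≤ Real.arsinh (u + θ) - Real.arsinh u := by
    have := Real.arsinh_le_arsinh.2 (show u ≤ u + θ by linarith); linarith
  have hIm : 0 ≤ Real.arsinh u - Real.arsinh (u - θ) := by
    have := Real.arsinh_le_arsinh.2 (show u - θ ≤ u by linarith); linarith
  have hwin : Real.arsinh (u + θ) - Real.arsinh (u - θ) ≤ 2 * θ / W := arsinh_window_le_far hθ0 hu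
  have hNN : 1 + 2 * x ^ 2 + x ^ 4 ≤ 1 + 2 * x + 2 * x ^ 2 + 2 * x ^ 3 + x ^ 4 := by nlinarith [pow_nonneg hx0 3]
  have hNp : 1 + 2 * x + 2 * x ^ 2 + 2 * x ^ 3 + x ^ 4 ≤ 1.0050126 := by
    have h2 : x ^ 2 ≤ (1 / 400) ^ 2 := pow_le_pow_left₀ hx0 hx 2
    have h3 : x ^ 3 ≤ (1 / 400) ^ 3 := pow_le_pow_left₀ hx0 hx 3
    have h4 : x ^ 4 ≤ (1 / 400) ^ 4 := pow_le_pow_left₀ hx0 hx 4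
    norm_num at h2 h3 h4 ⊢; linarith
  have hNp0 : 0 ≤ 1 + 2 * x + 2 * x ^ 2 + 2 * x ^ 3 + x ^ 4 := by positivity
  set F := (1 + 2 * x + 2 * x ^ 2 + 2 * x ^ 3 + x ^ 4) * (Real.arsinh (u + θ) - Real.arsinh u) +
    (1 + 2 * x ^ 2 + x ^ 4) * (Real.arsinh u - Real.arsinh (u - θ)) with hF_def
  have hF : F ≤ 1.0050126 * (2 * θ / W) := by
    calc F ≤ (1 + 2 * x + 2 * x ^ 2 + 2 * x ^ 3 + x ^ 4) * (Real.arsinh (u + θ) - Real.arsinh u) +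
          (1 + 2 * x + 2 * x ^ 2 + 2 * x ^ 3 + x ^ 4) * (Real.arsinh u - Real.arsinh (u - θ)) := by
            have := mul_le_mul_of_nonneg_right hNN hIm; rw [hF_def]; linarith
      _ = (1 + 2 * x + 2 * x ^ 2 + 2 * x ^ 3 + x ^ 4) * (Real.arsinh (u + θ) - Real.arsinh (u - θ)) := by ring
      _ ≤ 1.0050126 * (2 * θ / W) := mul_le_mul hNp hwin (by linarith) (by norm_num)
  have hF0 : 0 ≤ F := by rw [hF_def]; positivity
  have h1q : 0 < 1 - q := by norm_num at hq; linarith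
  have e : 4 * Real.pi * a * (a * (Real.pi / 2 + 2 * sawSigma0 a β) + 2 * a * ‖sawS a β‖) / (a * Real.sqrt (max 0 (sawC2 a β))) *
        (F / (((1 - q) * (2 * (2 * Real.pi * a))) * (2 * Real.pi * a))) = (R * (F / (1 - q))) / (2 * Real.pi * a) := by
    rw [hR_def]; field_simp; ring
  rw [e, div_le_div_iff₀ (by positivity) (by positivity)]
  have hFq : F / (1 - q) ≤ 1.0050127 * (2 * θ / W) := by
    rw [div_le_iff₀ h1q]
    have hθW : 0 ≤ 2 * θ / W := by positivity
    norm_num at hq ⊢; nlinarith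
  have hFq0 : 0 ≤ F / (1 - q) := by positivity
  have hθW : 0 ≤ 2 * θ / W := by positivity
  have h3 : R * (F / (1 - q)) ≤ 1.00002 * (1.0050127 * (2 * θ / W)) := mul_le_mul hR hFq hFq0 (by norm_num)
  -- `R·F/(1−q)·(a·W) ≤ 1.00002·1.0050127·16·a ≤ 2.57·2π·a`
  have h4 : R * (F / (1 - q)) * (a * W) ≤ 1.00002 * (1.0050127 * (2 * θ / W)) * (a * W) := mul_le_mul_of_nonneg_right h3 (by positivity)
  have h5 : 1.00002 * (1.0050127 * (2 * θ / W)) * (a * W) = 1.00002 * 1.0050127 * 2 * θ * a := by field_simp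
  rw [h5] at h4
  nlinarith


/-- Mirror of `arsinh_window_le_far`: for `u ≤ −θ ≤ 0`, `arsinh(u+θ) − arsinh(u−θ) ≤ 2θ/√(1+(u+θ)²)` (`arsinh` is odd). [folklore] -/
theorem arsinh_window_le_far_neg {θ u : ℝ} (hθ : 0 ≤ θ) (hu : u ≤ -θ) :
    Real.arsinh (u + θ) - Real.arsinh (u - θ) ≤ 2 * θ / Real.sqrt (1 + (u + θ) ^ 2) := by
  have h := arsinh_window_le_far hθ (show θ ≤ -u by linarith)
  rw [show -u + θ = -(u - θ) by ring, show -u - θ = -(u + θ) by ring, Real.arsinh_neg, Real.arsinh_neg, neg_sq] at h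
  linarith

/-- **Non-resonant tail of the mode factor, negative side:** for `a ≥ 4`, `0 ≤ θ ≤ 8`, `u = ξ/a ≤ −θ`:
the mode factor is `≤ 2.57/(a·√(1+(ξ/a+θ)²))`. [folklore] -/
theorem mode_factor_far_le_neg {a : ℝ} (ha : 4 ≤ a) (β ξ : ℝ) {θ : ℝ} (hθ0 : 0 ≤ θ) (hθ : θ ≤ 8) (hu : ξ / a ≤ -θ) :
    4 * Real.pi * a * (a * (Real.pi / 2 + 2 * sawSigma0 a β) + 2 * a * ‖sawS a β‖) / (a * Real.sqrt (max 0 (sawC2 a β))) *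
        (((1 + 2 * Real.exp (-(2 * Real.pi * a) / 4) + 2 * Real.exp (-(2 * Real.pi * a) / 4) ^ 2 + 2 * Real.exp (-(2 * Real.pi * a) / 4) ^ 3 +
            Real.exp (-(2 * Real.pi * a) / 4) ^ 4) * (Real.arsinh (ξ / a + θ) - Real.arsinh (ξ / a)) +
          (1 + 2 * Real.exp (-(2 * Real.pi * a) / 4) ^ 2 + Real.exp (-(2 * Real.pi * a) / 4) ^ 4) * (Real.arsinh (ξ / a) - Real.arsinh (ξ / a - θ))) /
          (((1 - Real.exp (-(2 * Real.pi * a))) * (2 * (2 * Real.pi * a))) * (2 * Real.pi * a))) ≤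
      2.57 / (a * Real.sqrt (1 + (ξ / a + θ) ^ 2)) := by
  have ha1 : 1 ≤ a := by linarith
  have ha0 : 0 < a := by linarith
  have hπ : (3.1415 : ℝ) < Real.pi := Real.pi_gt_d4
  have hR : (a * (Real.pi / 2 + 2 * sawSigma0 a β) + 2 * a * ‖sawS a β‖) / (a * Real.sqrt (max 0 (sawC2 a β))) ≤ 1.00002 :=
    (comb_ratio_le ha1 β).trans (by linarith [comb_ratio_defect_le ha β])
  have hR0 : 0 ≤ (a * (Real.pi / 2 + 2 * sawSigma0 a β) + 2 * a * ‖sawS a β‖) / (a * Real.sqrt (max 0 (sawC2 a β))) := by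
    have := kh_p_ge ha1 β; positivity
  have hx := exp_neg_quarter_kappa_le ha
  have hx0 : 0 ≤ Real.exp (-(2 * Real.pi * a) / 4) := (Real.exp_pos _).le
  have hq : Real.exp (-(2 * Real.pi * a)) ≤ (1 / 400) ^ 4 := exp_neg_kappa_le_pow ha
  have hq0 : 0 < Real.exp (-(2 * Real.pi * a)) := Real.exp_pos _
  set x := Real.exp (-(2 * Real.pi * a) / 4) with hxdef
  set q := Real.exp (-(2 * Real.pi * a)) with hqdef
  set u := ξ / a with hudef
  set R := (a * (Real.pi / 2 + 2 * sawSigma0 a β) + 2 * a * ‖sawS a β‖) / (a * Real.sqrt (max 0 (sawC2 a β))) with hR_def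
  set W := Real.sqrt (1 + (u + θ) ^ 2) with hW
  have hW0 : 0 < W := Real.sqrt_pos.2 (by positivity)
  -- the envelope factor: `N₋ ≤ N₊`, `I₊, I₋ ≥ 0`, `I₊ + I₋ ≤ 2θ/W`
  have hIp : 0 ≤ Real.arsinh (u + θ) - Real.arsinh u := by
    have := Real.arsinh_le_arsinh.2 (show u ≤ u + θ by linarith); linarith
  have hIm : 0 ≤ Real.arsinh u - Real.arsinh (u - θ) := by
    have := Real.arsinh_le_arsinh.2 (show u - θ ≤ u by linarith); linarith
  have hwin : Real.arsinh (u + θ) - Real.arsinh (u - θ) ≤ 2 * θ / W := arsinh_window_le_far_neg hθ0 hu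
  have hNN : 1 + 2 * x ^ 2 + x ^ 4 ≤ 1 + 2 * x + 2 * x ^ 2 + 2 * x ^ 3 + x ^ 4 := by nlinarith [pow_nonneg hx0 3]
  have hNp : 1 + 2 * x + 2 * x ^ 2 + 2 * x ^ 3 + x ^ 4 ≤ 1.0050126 := by
    have h2 : x ^ 2 ≤ (1 / 400) ^ 2 := pow_le_pow_left₀ hx0 hx 2
    have h3 : x ^ 3 ≤ (1 / 400) ^ 3 := pow_le_pow_left₀ hx0 hx 3
    have h4 : x ^ 4 ≤ (1 / 400) ^ 4 := pow_le_pow_left₀ hx0 hx 4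
    norm_num at h2 h3 h4 ⊢; linarith
  have hNp0 : 0 ≤ 1 + 2 * x + 2 * x ^ 2 + 2 * x ^ 3 + x ^ 4 := by positivity
  set F := (1 + 2 * x + 2 * x ^ 2 + 2 * x ^ 3 + x ^ 4) * (Real.arsinh (u + θ) - Real.arsinh u) +
    (1 + 2 * x ^ 2 + x ^ 4) * (Real.arsinh u - Real.arsinh (u - θ)) with hF_def
  have hF : F ≤ 1.0050126 * (2 * θ / W) := by
    calc F ≤ (1 + 2 * x + 2 * x ^ 2 + 2 * x ^ 3 + x ^ 4) * (Real.arsinh (u + θ) - Real.arsinh u) +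
          (1 + 2 * x + 2 * x ^ 2 + 2 * x ^ 3 + x ^ 4) * (Real.arsinh u - Real.arsinh (u - θ)) := by
            have := mul_le_mul_of_nonneg_right hNN hIm; rw [hF_def]; linarith
      _ = (1 + 2 * x + 2 * x ^ 2 + 2 * x ^ 3 + x ^ 4) * (Real.arsinh (u + θ) - Real.arsinh (u - θ)) := by ring
      _ ≤ 1.0050126 * (2 * θ / W) := mul_le_mul hNp hwin (by linarith) (by norm_num)
  have hF0 : 0 ≤ F := by rw [hF_def]; positivity
  have h1q : 0 < 1 - q := by norm_num at hq; linarith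
  have e : 4 * Real.pi * a * (a * (Real.pi / 2 + 2 * sawSigma0 a β) + 2 * a * ‖sawS a β‖) / (a * Real.sqrt (max 0 (sawC2 a β))) *
        (F / (((1 - q) * (2 * (2 * Real.pi * a))) * (2 * Real.pi * a))) = (R * (F / (1 - q))) / (2 * Real.pi * a) := by
    rw [hR_def]; field_simp; ring
  rw [e, div_le_div_iff₀ (by positivity) (by positivity)]
  have hFq : F / (1 - q) ≤ 1.0050127 * (2 * θ / W) := by
    rw [div_le_iff₀ h1q]
    have hθW : 0 ≤ 2 * θ / W := by positivity
    norm_num at hq ⊢; nlinarith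
  have hFq0 : 0 ≤ F / (1 - q) := by positivity
  have hθW : 0 ≤ 2 * θ / W := by positivity
  have h3 : R * (F / (1 - q)) ≤ 1.00002 * (1.0050127 * (2 * θ / W)) := mul_le_mul hR hFq hFq0 (by norm_num)
  -- `R·F/(1−q)·(a·W) ≤ 1.00002·1.0050127·16·a ≤ 2.57·2π·a`
  have h4 : R * (F / (1 - q)) * (a * W) ≤ 1.00002 * (1.0050127 * (2 * θ / W)) * (a * W) := mul_le_mul_of_nonneg_right h3 (by positivity)
  have h5 : 1.00002 * (1.0050127 * (2 * θ / W)) * (a * W) = 1.00002 * 1.0050127 * 2 * θ * a := by field_simp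
  rw [h5] at h4
  nlinarith


/-- **Far modes never un-tilt: the mode factor decays like `1/|ξ|`.** For `a ≥ 4`, `0 ≤ θ ≤ 8` and `|ξ| ≥ 16a` the mode factor is `≤ 5.14/|ξ|`
(both signs of `ξ`; `√(1+(|u|−θ)²) ≥ |u| − 8 ≥ |u|/2`). [folklore] -/
theorem mode_factor_le_of_far {a : ℝ} (ha : 4 ≤ a) (β ξ : ℝ) {θ : ℝ} (hθ0 : 0 ≤ θ) (hθ : θ ≤ 8) (hfar : 16 * a ≤ |ξ|) :
    4 * Real.pi * a * (a * (Real.pi / 2 + 2 * sawSigma0 a β) + 2 * a * ‖sawS a β‖) / (a * Real.sqrt (max 0 (sawC2 a β))) *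
        (((1 + 2 * Real.exp (-(2 * Real.pi * a) / 4) + 2 * Real.exp (-(2 * Real.pi * a) / 4) ^ 2 + 2 * Real.exp (-(2 * Real.pi * a) / 4) ^ 3 +
            Real.exp (-(2 * Real.pi * a) / 4) ^ 4) * (Real.arsinh (ξ / a + θ) - Real.arsinh (ξ / a)) +
          (1 + 2 * Real.exp (-(2 * Real.pi * a) / 4) ^ 2 + Real.exp (-(2 * Real.pi * a) / 4) ^ 4) * (Real.arsinh (ξ / a) - Real.arsinh (ξ / a - θ))) /
          (((1 - Real.exp (-(2 * Real.pi * a))) * (2 * (2 * Real.pi * a))) * (2 * Real.pi * a))) ≤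
      5.14 / |ξ| := by
  have ha0 : 0 < a := by linarith
  rcases le_or_gt 0 ξ with hξ | hξ
  · rw [abs_of_nonneg hξ] at hfar ⊢
    have hu : 16 ≤ ξ / a := by rw [le_div_iff₀ ha0]; linarith
    have hξ0 : 0 < ξ := by nlinarith
    refine (mode_factor_far_le ha β ξ hθ0 hθ (by linarith)).trans ?_
    have hs : ξ / a / 2 ≤ Real.sqrt (1 + (ξ / a - θ) ^ 2) := by
      refine le_trans ?_ (Real.sqrt_le_sqrt (by nlinarith : (ξ / a - θ) ^ 2 ≤ 1 + (ξ / a - θ) ^ 2))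
      rw [Real.sqrt_sq (by linarith)]
      linarith
    rw [div_le_div_iff₀ (by positivity) hξ0]
    have : 2.57 * ξ = 5.14 * (a * (ξ / a / 2)) := by field_simp; ring
    rw [this]
    exact mul_le_mul_of_nonneg_left (mul_le_mul_of_nonneg_left hs ha0.le) (by norm_num)
  · rw [abs_of_neg hξ] at hfar ⊢
    have hu : ξ / a ≤ -16 := by rw [div_le_iff₀ ha0]; linarith
    have hξ0 : 0 < -ξ := by linarith
    refine (mode_factor_far_le_neg ha β ξ hθ0 hθ (by linarith)).trans ?_
    have hs : -(ξ / a) / 2 ≤ Real.sqrt (1 + (ξ / a + θ) ^ 2) := by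
      refine le_trans ?_ (Real.sqrt_le_sqrt (by nlinarith : (ξ / a + θ) ^ 2 ≤ 1 + (ξ / a + θ) ^ 2))
      rw [show (ξ / a + θ) ^ 2 = (-(ξ / a) - θ) ^ 2 by ring, Real.sqrt_sq (by linarith)]
      linarith
    rw [div_le_div_iff₀ (by positivity) hξ0]
    have : 2.57 * -ξ = 5.14 * (a * (-(ξ / a) / 2)) := by field_simp; ring
    rw [this]
    exact mul_le_mul_of_nonneg_left (mul_le_mul_of_nonneg_left hs ha0.le) (by norm_num)

end Summit.AnomalousDissipation.AnomalousDissipation.Theorems.SawtoothPulseCascade.K2PhaseBudget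

end
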